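import Literature.IUT.HodgeArakelov.ThetaEnvDataRecordProp31ThetaHalfAtModelTate
import Literature.IUT.HodgeArakelov.BadPrimeGaussianMonoidsUnitsSaturationOfTower
import HarnessLib

/-!
# [IUTchII] Prop 3.1 (i)(ii) AT THE GENUINE `θ_env` RECORD OF THE TATE MODEL with PRINT'S constant monoid
# `Ψ_cns := κ(𝒪^▷_{ℚ̄_p})` — the `O`/stabiliser binders DISCHARGED BY NAME (proof-only; K-L6 instance bookkeeping)

S. Mochizuki, *Inter-universal Teichmüller theory II*, kurims manuscript (Dec. 2020), §3 Prop. 3.1 (i) p. 87, (ii) p. 88 l.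
1–10 («`Ψ_cns(M^Θ_*) := M_TM(M^Θ_*) ⊆ …` … naturally isomorphic to `O^▷_{F̄_v}` … equipped with a natural conjugation
action») [cite: Mochizuki2012, Prop 3.1 (ii) p.88]; the constant monoid `𝒪^▷_{k̄}` is [AbsTopIII] Def. 3.1 (i) p. 66
(abc-iut-L4's `Literature.AnabelianGeometry.AbsoluteAnabelian.nonzeroIntegers`) [cite: MochizukiAbsTopIII2015, Definition
3.1 (i) p.66]. Claim key `Mochizuki2012` (D-0012, DISPUTED): nothing of the series is asserted; composition of LANDED
theorems over the cell's OWN model objects; no side taken on [IUTchIII] Cor. 3.12. PROOF-ONLY companion (abc-iut cell, layer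
L6, seat abc-iut-w5-d031 gen 12; cone node IUTchII:Prop3.1(i)/(ii), K-L6 instance of record; L-F row LF6-02 = FACT-LIST
F-2567 `TemperedThetaMonoids.Prop31Statements`). NO definition, NO `Prop` fact, NO instance; nothing landed is edited.

WHAT. The model-of-record theorems `EtaleLevels.prop31Statements_thetaEnvRecordOuterKummer_modelTate` (abc-iut-w5-d031 g11,
p493591) and `…prop31Statements_and_thetaEnv_thetaEnvRecordOuterKummer_modelTate` (g12, p495887) are stated for an ARBITRARY
constant monoid `O ≤ ℚ̄_pˣ` with the four binders `hOtors` (torsion and its inverses lie in `O`), `hA`/`hfi` (stabilisers in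
`Π^tp_{X̲̲}` of units of `ℚ̄_p` are open / of finite index) and `hOst` (`Π^tp_{X̲̲}`-stability of `O`). THIS FILE
specialises them to PRINT'S constant monoid `O := 𝒪^▷_{ℚ̄_p}` pulled back to `ℚ̄_pˣ` — `(nonzeroIntegers ℚ_[p] (PadicAlgCl
p)).comap (Units.coeHom _)`, the choice already of record in the Cor. 3.5/3.6 files of abc-iut-w4-d007 / abc-iut-w5-d192 —
and DISCHARGES all four BY NAME: `hOtors` ⟸ abc-iut-w5-d192's `mem_comap_nonzeroIntegers_padic_of_isOfFinOrder'` (roots of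
unity are integral units; applied to `a` and to `a⁻¹`, `IsOfFinOrder.inv`); `hA` / `hfi` ⟸ abc-iut-w4-d007's
`EtaleThetaDataOfSetting.isOpen_stabilizer_units` / `finiteIndex_stabilizer_units` (the Galois action of `Π^tp_{X̲̲}` on
`ℚ̄_pˣ` through `ε`, `unitsAction`); `hOst` ⟸ abc-iut-w5-d192's
`EtaleThetaDataOfSetting.smul_mem_comap_nonzeroIntegers_padic` (abc-iut-L4's `smul_mem_nonzeroIntegers`: a
`ℚ_p`-automorphism maps integral elements to integral elements). Result:
**`prop31Statements_and_thetaEnv_thetaEnvRecordOuterKummer_modelTate_nonzeroIntegers`** — at the genuine `θ_env` record of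
`modelTate p` (outer inversion family through the pointed pair) with `Ψ_cns := κ(𝒪^▷_{ℚ̄_p})`, the WHOLE `Prop31Statements`
∧ the `θ^ι_env`-splitting clause at EVERY label. RESIDUAL (every binder after the `let`s, BY NAME): {(H1)
`PiYddCharacteristic C` (F-2633 AT THE INSTANCE; ⟺ `L_Ÿ♯` by abc-iut-w6-d055's p495340), the tower `τ` (DATA), and the
[IUTchII] Cor. 3.5 (K)/(E) DATA of p461404: coefficient isomorphisms `c`/`c₀` bijective with `c₀ = c` on elements, ONE
evaluation section `s₀` with `hact` and finite-index image, a base point `θ ∈ θ^{1}_env` with evaluation `R₀ θ = κ₀ q` for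
some `q ∈ 𝒪^▷_{ℚ̄_p}` that is NOT a unit of `𝒪^▷_{ℚ̄_p}`} — five binders FEWER than p495887 (`O`, `hOtors`, `hA`, `hfi`,
`hOst` gone; `O` fixed to print's).

HONEST LABEL. `modelTate` is a SEMI-SYNTHETIC model of the typed [EtTh] §1 interface (not the tempered `π₁` of a curve, no
theta FUNCTION): binder-discharge / joint-satisfiability evidence for the typed interface only; an instance at OUR model is
not the print universal closure (refuted as a schema). Nothing of [IUTchII]/[EtTh]/[AbsTopIII] is asserted; no side is taken
on [IUTchIII] Cor. 3.12; typed ≠ proved; instantiated ≠ endorsed; nothing here bears on whether abc is proved or refuted.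
[claim: Mochizuki2012, status: disputed] -/

noncomputable section

open Literature.AnabelianGeometry.EtaleTheta (ContH1 ThetaSetting)
open Literature.AnabelianGeometry.EtaleTheta
open Literature.AnabelianGeometry.AbsoluteAnabelian (nonzeroIntegers)
open _root_.Topology

namespace Literature.IUT.HodgeArakelov

namespace EtaleLevels

open CohomologySystemOfContH1 EtaleThetaDataOfSetting TemperedThetaMonoids BadPrimeGaussianMonoids
open Literature.AnabelianGeometry.EtaleTheta.SettingModel
open Literature.AnabelianGeometry.SemiGraphs

section TateRecord

open ModelTateCarriers

variable (p : ℕ) [Fact p.Prime] (l : ℕ+) (hlo : Odd (l : ℕ)) (hlp : (l : ℕ).Prime) (hdvd : 4 * (l : ℕ) ∣ p - 1)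
  {Es : Set ℕ+} (τ : (ThetaSetting.modelTate p).CyclotomeTower l Es)

/-- **[IUTchII] Prop. 3.1 (i)(ii) at the genuine `θ_env` record of the Tate model with PRINT'S constant monoid `Ψ_cns :=
κ(𝒪^▷_{ℚ̄_p})`** (`modelTate p`, Galois factor `inr`, class `η̈♯ = etaDdχq`, `X̲̲ := Huuχq` of record, root cocycle
`rootLift`, cyclotome family `τ.modAll`, EMPTY cusp labelling, `l` an odd prime with `4l ∣ p − 1`; inversions = the
`Π^tp_{X̲̲}`-conjugates of `e₀ := pairRhoLim …` of the pointed pair; `O := 𝒪^▷_{ℚ̄_p}` pulled back to `ℚ̄_pˣ`): the packaged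
`Prop31Statements` (`conj_permutes`; `splitting` for `∞θ^ι_env` at every `ι`; `constants_stable`) AND the
`θ^ι_env`-splitting clause at EVERY `ι`. ONE application of p495887 with `hOtors` :=
`mem_comap_nonzeroIntegers_padic_of_isOfFinOrder'` (at `a` and `a⁻¹`), `hA` := `isOpen_stabilizer_units`, `hfi` :=
`finiteIndex_stabilizer_units`, `hOst` := `smul_mem_comap_nonzeroIntegers_padic` — all THEOREMS of the tree. RESIDUAL (every
binder after the `let`s): {(H1) `PiYddCharacteristic C`, the tower `τ`, the Cor 3.5 (K)/(E) DATA `c`/`c₀`/`s₀`/`hact`/finite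
index/`θ ∈ θ^{1}_env`/`R₀`/`q ∈ 𝒪^▷` non-unit with `R₀ θ = κ₀ q`}. SEMI-SYNTHETIC MODEL, binder-discharge evidence only; no
side taken on [IUTchIII] Cor. 3.12. [claim: Mochizuki2012, status: disputed] (IUTchII §3 Prop 3.1 (ii), kurims p.88) -/
theorem prop31Statements_and_thetaEnv_thetaEnvRecordOuterKummer_modelTate_nonzeroIntegers
    [TopologicalSpace (PadicAlgCl p)ˣ] {P₀ : TopGroup.{0}} (φ₀ : P₀ →* (ThetaSetting.modelTate p).GtpTheta)
    [MulDistribMulAction P₀ (PadicAlgCl p)ˣ]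
    (hA₀ : ∀ b : (PadicAlgCl p)ˣ, IsOpen (MulAction.stabilizer P₀ b : Set P₀))
    (hfi₀ : ∀ b : (PadicAlgCl p)ˣ, (MulAction.stabilizer P₀ b).FiniteIndex) :
    let O : Submonoid (PadicAlgCl p)ˣ := (nonzeroIntegers ℚ_[p] (PadicAlgCl p)).comap (Units.coeHom (PadicAlgCl p))
    let hS := ThetaSetting.modelχq_sec2Hyps p 1 2 even_two
    let hC := compat_modelχq p 1 2 even_two
    let K₀ := (kummerCoreχq p 1 2 even_two).toKummerDataOfSection SemidirectProduct.inr (continuous_inrχq p 1 2)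
        (fun _ => rfl) (map_inr_GK_le_GtpY_modelχq' p 1 2 even_two) (map_inr_GKdd_le_GtpYdd_modelχq' p 1 2 even_two)
    let E := K₀.etaleThetaDataOfClass (etaDdχq p 1 2 even_two)
    let C := E.doubleUnderlineχqOfEtaRes p 1 2 l hlo (eta_res_etaDdχq p 1 2 even_two l hlo)
    let h15 : ThetaSetting.Prop15iii E hC :=
      prop15iii_etaleThetaDataOfClass_etaDdχq p hC SemidirectProduct.inr (continuous_inrχq p 1 2) (fun _ => rfl)
        (map_inr_GK_le_GtpY_modelχq' p 1 2 even_two) (map_inr_GKdd_le_GtpYdd_modelχq' p 1 2 even_two)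
    let L : C.CuspLabels := ⟨fun _ => ∅, fun _ => ∅, fun _ => rfl⟩
    let hO := ThetaSetting.modelχq_isEtThOrigin p 1 2 even_two
    let hYcl := hYcl_modelχq p 1 2 even_two
    let hp2 := ne_two_of_four_mul_dvd_pred p l.pos hdvd
    let hpl := ne_of_four_mul_dvd_pred p l.pos hdvd
    let hζ := exists_isPrimitiveRoot_K_modelχq p 1 2 even_two l.pos hdvd
    let hZ : ∀ M : ℕ+, Nonempty (ModelCyclotomes.lDeltaQuot (C.rigidData (τ.modAll M) hC hS h15 L) ≃*
        Literature.IUT.HodgeTheaters.ZHat) := fun M =>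
      ModelCyclotomes.nonempty_lDeltaQuot_rigidData_mulEquiv_zHat C (τ.modAll M) hC hS h15 L hO hYcl hlp.ne_zero
    let hlim := bijective_rigidLimHom C hC hS hlp hp2 hpl hζ τ.modAll (EtaleThetaDataOfSetting.rootLift C)
      (rootLift_mem_rootCocycles C hC) τ.red_modAll h15 L hZ
    let cι : ThetaSetting.ThetaCompanion (Dα := ThetaSetting.modelTate p) (Dβ := ThetaSetting.modelTate p) (inversionχq p 1 2) :=
      (ThetaSetting.modelTate p).thetaCompanionOfAut (inversionχq p 1 2)
        (isInversionAut_inversionχq p 1 2 even_two).map_deltaTemp (hasThetaTopology_modelχq p 1 2 even_two).isQuotientMap_toTheta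
    haveI := piYdd_normal C hC
    haveI : ((ThetaSetting.modelTate p).lDeltaTheta l).Normal := ThetaSetting.lDeltaTheta_normal _ l
    haveI : IsMulCommutative ((ThetaSetting.modelTate p).lDeltaTheta l) :=
      EtaleThetaDataOfSetting.instIsMulCommutative_lDeltaTheta (D := ThetaSetting.modelTate p) l
    letI : MulDistribMulAction (Pi C) (PadicAlgCl p)ˣ := EtaleThetaDataOfSetting.unitsAction C
    let hA : ∀ b : (PadicAlgCl p)ˣ, IsOpen (MulAction.stabilizer (Pi C) b : Set (Pi C)) :=
      EtaleThetaDataOfSetting.isOpen_stabilizer_units C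
    let hfi : ∀ b : (PadicAlgCl p)ˣ, (MulAction.stabilizer (Pi C) b).FiniteIndex :=
      EtaleThetaDataOfSetting.finiteIndex_stabilizer_units C
    ∀ (hcharY : PiYddCharacteristic C),
    let e₀ : h1Lim (phi C) ((ThetaSetting.modelTate p).lDeltaTheta l) (PiYdd C) ⊥ ≃+
        h1Lim (phi C) ((ThetaSetting.modelTate p).lDeltaTheta l) (PiYdd C) ⊥ :=
      pairRhoLim C (inversionAlpha C (inversionχq p 1 2) (map_Huuχq_inversionχq p 1 2 l hlo)) cι.thetaIso
        (thetaCompanion_phi C (inversionχq p 1 2) (map_Huuχq_inversionχq p 1 2 l hlo) cι)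
        (mem_lDeltaTheta_iff_thetaCompanion (D := ThetaSetting.modelTate p) (inversionχq p 1 2) cι l)
        (mem_PiYdd_iff_of_piYddCharacteristic C hcharY _)
    ∀ (s₀ : P₀ →* Pi C) (hs₀ : Continuous ((MonoidHom.id (Pi C)).comp s₀))
      (hN : (⊤ : Subgroup P₀).map ((MonoidHom.id (Pi C)).comp s₀) ≤ PiYdd C)
      (hφ : (phi C).comp ((MonoidHom.id (Pi C)).comp s₀) = φ₀)
      (c : CyclotomeCoefficients (phi C) ((ThetaSetting.modelTate p).lDeltaTheta l) (PadicAlgCl p)ˣ)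
      (c₀ : CyclotomeCoefficients φ₀ ((ThetaSetting.modelTate p).lDeltaTheta l) (PadicAlgCl p)ˣ)
      (_hc : Function.Bijective c.hom) (_hc₀ : Function.Bijective c₀.hom) (_hc₀c : ∀ ζ, c₀.hom ζ = c.hom ζ)
      (_hact : ∀ (g : P₀) (a : (PadicAlgCl p)ˣ), g • a = s₀ g • a)
      [((EtaleThetaDataOfSetting.aug C).comp s₀).range.FiniteIndex]
      {θ : (thetaEnvRecordOuterKummer C hC hS hlp hp2 hpl hζ τ.modAll (EtaleThetaDataOfSetting.rootLift C)
        (rootLift_mem_rootCocycles C hC) τ.red_modAll h15 L hZ hcharY hlim e₀ c hA hfi O).H}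
      (_hθ : θ ∈ (thetaEnvRecordOuterKummer C hC hS hlp hp2 hpl hζ τ.modAll (EtaleThetaDataOfSetting.rootLift C)
        (rootLift_mem_rootCocycles C hC) τ.red_modAll h15 L hZ hcharY hlim e₀ c hA hfi O).thetaEnv (1 : Pi C))
      (R₀ : (thetaEnvRecordOuterKummer C hC hS hlp hp2 hpl hζ τ.modAll (EtaleThetaDataOfSetting.rootLift C)
          (rootLift_mem_rootCocycles C hC) τ.red_modAll h15 L hZ hcharY hlim e₀ c hA hfi O).H →*
        Multiplicative (h1Lim φ₀ ((ThetaSetting.modelTate p).lDeltaTheta l) (⊤ : Subgroup P₀) ⊥))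
      (_hR₀ : ∀ y, Multiplicative.toAdd (R₀ y) =
        h1LimCongr ((ThetaSetting.modelTate p).lDeltaTheta l) ⊤ hφ ⊥
          (h1LimComap (phi C) ((ThetaSetting.modelTate p).lDeltaTheta l) ((MonoidHom.id (Pi C)).comp s₀) hs₀ hN
            (AddEquiv.additiveMultiplicative (h1Lim (phi C) ((ThetaSetting.modelTate p).lDeltaTheta l) (PiYdd C) ⊥)
              (Additive.ofMul y))))
      (q : O) (_hRθ : R₀ θ = h1LimKummerOn φ₀ ((ThetaSetting.modelTate p).lDeltaTheta l) ⊤ c₀ hA₀ hfi₀ O q)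
      (_hq : ¬ IsUnit q),
      TemperedThetaMonoids.Prop31Statements
          (thetaEnvRecordOuterKummer C hC hS hlp hp2 hpl hζ τ.modAll (EtaleThetaDataOfSetting.rootLift C)
            (rootLift_mem_rootCocycles C hC) τ.red_modAll h15 L hZ hcharY hlim e₀ c hA hfi O) ∧
        ∀ j : Pi C, TemperedThetaMonoids.IsSplittingUpToTorsion
          (thetaEnvRecordOuterKummer C hC hS hlp hp2 hpl hζ τ.modAll (EtaleThetaDataOfSetting.rootLift C)
            (rootLift_mem_rootCocycles C hC) τ.red_modAll h15 L hZ hcharY hlim e₀ c hA hfi O).units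
          (Submonoid.closure ((thetaEnvRecordOuterKummer C hC hS hlp hp2 hpl hζ τ.modAll
            (EtaleThetaDataOfSetting.rootLift C) (rootLift_mem_rootCocycles C hC) τ.red_modAll h15 L hZ hcharY hlim
            e₀ c hA hfi O).thetaEnv j)) := by
  intro O hS hC K₀ E C h15 L hO hYcl hp2 hpl hζ hZ hlim cι hA hfi hcharY e₀ s₀ hs₀ hN hφ c c₀ hc hc₀ hc₀c hact _ θ hθ R₀ hR₀ q
    hRθ hq
  have hOtors : ∀ a : (PadicAlgCl p)ˣ, IsOfFinOrder a → a ∈ O ∧ a⁻¹ ∈ O := fun a ha =>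
    ⟨mem_comap_nonzeroIntegers_padic_of_isOfFinOrder' ha, mem_comap_nonzeroIntegers_padic_of_isOfFinOrder' ha.inv⟩
  exact prop31Statements_and_thetaEnv_thetaEnvRecordOuterKummer_modelTate p l hlo hlp hdvd τ O hOtors φ₀ hA₀ hfi₀ hcharY s₀
    hs₀ hN hφ c hA hfi (fun σ b hb => EtaleThetaDataOfSetting.smul_mem_comap_nonzeroIntegers_padic C σ hb) c₀ hc hc₀ hc₀c
    hact hθ R₀ hR₀ q hRθ hq

end TateRecord

end EtaleLevels

end Literature.IUT.HodgeArakelov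

end
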